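import Mathlib
import HarnessLib
import Summits.Ventures.LatticeQCDFlow.Exactness.CreutzSampler

/-!
# The engine's `KP_SWITCH = 2`: per round, Kennedy–Pendleton accepts more often than Creutz for `bt ≥ 2`, less often for `bt ≤ 3/2`

HONEST FRAMING: exact (Metropolis-corrected) sampling algorithms for lattice gauge theory;
figures of merit are autocorrelation/cost numbers at stated couplings and volumes; no
continuum-physics claim.

Venture `LatticeQCDFlow` (cell pub-lqcd), topic `Exactness`, FANOUT row 9 (eng-latcore, the
engine `latflow.core`).  NEW WORK of the cell over row 9's `KennedyPendletonSampler.lean`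
(`kpRound_accept`: acceptance per KP round `= kpConst bt · a0Law bt ℝ`) and `CreutzSampler.lean`
(`loopLaw_creutzRound`: acceptance per Creutz round `= creutzConst bt · a0Law bt ℝ`).  Nothing is
cited as a fact.  Printed counterpart, NAMED ONLY: Kennedy–Pendleton 1985 (who recommend their
method "for large β").

`csrc/latcore_template.c` dispatches `sample_a0` on `bt ≥ KP_SWITCH` with `KP_SWITCH = 2.0`
(`updates.py` the same).  Both rounds accept with probability (constant) × (the same mass
`a0Law bt ℝ`), so the per-round acceptance ratio is `kpConst bt / creutzConst bt
= √(2bt/π) · (1 − e^{−2bt})`.  This file proves the two-sided bracket of the switch: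

* **`creutzConst_le_kpConst`** — for `bt ≥ 2`, `creutzConst bt ≤ kpConst bt` (KP accepts at least
  as often per round); **`kpRound_accept_ge_creutz`** — the same for the rounds' acceptance
  probabilities;
* **`kpConst_le_creutzConst`** — for `0 < bt ≤ 3/2`, `kpConst bt ≤ creutzConst bt`.

NOT CLAIMED: wall-clock cost (a KP round spends four uniforms, a `cos` and two `log`s; a Creutz
round two uniforms, a `log` and an `exp`); the exact crossover (`≈ 1.66`); floating point.
-/

namespace Summit.Ventures.LatticeQCDFlow.Exactness

open MeasureTheory Measure Set Real
open scoped ENNReal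

/-- `√2 ∈ [1.41421, 1.41422]`, `√π ∈ [1.77243, 1.7725]`. -/
theorem sqrt_two_pi_bounds :
    (1.41421 : ℝ) ≤ Real.sqrt 2 ∧ Real.sqrt 2 ≤ 1.41422 ∧ (1.77243 : ℝ) ≤ Real.sqrt π ∧ Real.sqrt π ≤ 1.7725 := by
  refine ⟨?_, ?_, ?_, ?_⟩
  · exact Real.le_sqrt_of_sq_le (by norm_num)
  · exact (Real.sqrt_le_left (by norm_num)).mpr (by norm_num)
  · exact Real.le_sqrt_of_sq_le (by nlinarith [Real.pi_gt_d20])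
  · exact (Real.sqrt_le_left (by norm_num)).mpr (by nlinarith [Real.pi_lt_d4])

/-- `e^{−4} ≤ 1/50`. -/
theorem exp_neg_four_le : Real.exp (-4) ≤ 1 / 50 := by
  have h1 : (2.7182818283 : ℝ) < Real.exp 1 := Real.exp_one_gt_d9
  have h4 : Real.exp 4 = Real.exp 1 ^ 4 := by
    rw [← Real.exp_nat_mul 1 4]; norm_num
  have h50 : (50 : ℝ) ≤ Real.exp 4 := by
    rw [h4]
    have : (2.7182818283 : ℝ) ^ 4 ≤ Real.exp 1 ^ 4 := by gcongr
    nlinarith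
  rw [Real.exp_neg, inv_eq_one_div, div_le_div_iff₀ (Real.exp_pos 4) (by norm_num : (0 : ℝ) < 50)]
  linarith

/-- **KP accepts at least as often as Creutz per round when `bt ≥ 2`**: `creutzConst bt ≤ kpConst bt`,
i.e. `(π/2)·bt e^{−bt}/(1−e^{−2bt}) ≤ bt√bt e^{−bt}√π/√2`. -/
theorem creutzConst_le_kpConst {bt : ℝ} (hbt : 2 ≤ bt) : creutzConst bt ≤ kpConst bt := by
  obtain ⟨h2l, h2u, hπl, hπu⟩ := sqrt_two_pi_bounds
  have hbt0 : 0 < bt := by linarith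
  have hem : Real.exp (-2 * bt) ≤ 1 / 50 :=
    (Real.exp_le_exp.mpr (by linarith)).trans exp_neg_four_le
  have hem0 : 0 < 1 - Real.exp (-2 * bt) := by linarith
  have hsb : Real.sqrt 2 ≤ Real.sqrt bt := Real.sqrt_le_sqrt hbt
  have hππ : Real.sqrt π * Real.sqrt π = π := Real.mul_self_sqrt pi_pos.le
  rw [creutzConst, kpConst]
  apply ENNReal.ofReal_le_ofReal
  -- reduce to `√π √2 / 2 ≤ √bt (1 − e^{−2bt})`
  have key : Real.sqrt π * Real.sqrt 2 / 2 ≤ Real.sqrt bt * (1 - Real.exp (-2 * bt)) := by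
    have h1 : Real.sqrt π * Real.sqrt 2 ≤ 1.7725 * 1.41422 :=
      mul_le_mul hπu h2u (Real.sqrt_nonneg _) (by norm_num)
    have h2 : 1.41421 * (49 / 50 : ℝ) ≤ Real.sqrt bt * (1 - Real.exp (-2 * bt)) :=
      mul_le_mul (h2l.trans hsb) (by linarith) (by norm_num) (Real.sqrt_nonneg _)
    linarith
  have hs2 : 0 < Real.sqrt 2 := by positivity
  have hsπ : 0 < Real.sqrt π := Real.sqrt_pos.mpr pi_pos
  set sπ := Real.sqrt π with hsπdef
  rw [show π = sπ * sπ from hππ.symm, ← sub_nonneg]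
  have hid : bt * Real.sqrt bt * Real.exp (-bt) * sπ / Real.sqrt 2 -
      sπ * sπ / 2 * (bt * Real.exp (-bt) / (1 - Real.exp (-2 * bt))) =
      (bt * Real.exp (-bt) * sπ) * (Real.sqrt bt / Real.sqrt 2 - sπ / (1 - Real.exp (-2 * bt)) / 2) := by
    ring
  rw [hid]
  refine mul_nonneg (mul_nonneg (mul_nonneg hbt0.le (Real.exp_pos _).le) hsπ.le) (sub_nonneg.mpr ?_)
  rw [div_div, div_le_div_iff₀ (by positivity) hs2]
  linarith [key]

/-- … hence the KP ROUND accepts at least as often as the Creutz round for every `bt ≥ 2`. -/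
theorem kpRound_accept_ge_creutz {bt : ℝ} (hbt : 2 ≤ bt) :
    creutzRound bt (univ ×ˢ {true}) ≤ kpRound bt (univ ×ˢ {true}) := by
  have hbt0 : 0 < bt := by linarith
  rw [(loopLaw_creutzRound hbt0).1, kpRound_accept hbt0]
  gcongr
  exact creutzConst_le_kpConst hbt

/-- **Creutz accepts at least as often as KP per round when `0 < bt ≤ 3/2`**: `kpConst bt ≤ creutzConst bt`. -/
theorem kpConst_le_creutzConst {bt : ℝ} (hbt0 : 0 < bt) (hbt : bt ≤ 3 / 2) : kpConst bt ≤ creutzConst bt := by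
  obtain ⟨h2l, h2u, hπl, hπu⟩ := sqrt_two_pi_bounds
  have hem1 : Real.exp (-2 * bt) < 1 := exp_neg_two_mul_lt_one hbt0
  have hem0 : 0 < 1 - Real.exp (-2 * bt) := by linarith
  have hemle : 1 - Real.exp (-2 * bt) ≤ 1 := by linarith [Real.exp_pos (-2 * bt)]
  have hsb : Real.sqrt bt ≤ 1.22475 :=
    (Real.sqrt_le_sqrt hbt).trans ((Real.sqrt_le_left (by norm_num)).mpr (by norm_num))
  have hππ : Real.sqrt π * Real.sqrt π = π := Real.mul_self_sqrt pi_pos.le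
  rw [creutzConst, kpConst]
  apply ENNReal.ofReal_le_ofReal
  have key : Real.sqrt bt * (1 - Real.exp (-2 * bt)) ≤ Real.sqrt π * Real.sqrt 2 / 2 := by
    have h1 : (1.77243 : ℝ) * 1.41421 ≤ Real.sqrt π * Real.sqrt 2 :=
      mul_le_mul hπl h2l (by norm_num) (Real.sqrt_nonneg _)
    have h2 : Real.sqrt bt * (1 - Real.exp (-2 * bt)) ≤ 1.22475 * 1 :=
      mul_le_mul hsb hemle hem0.le (by norm_num)
    linarith
  have hs2 : 0 < Real.sqrt 2 := by positivity
  have hsπ : 0 < Real.sqrt π := Real.sqrt_pos.mpr pi_pos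
  set sπ := Real.sqrt π with hsπdef
  rw [show π = sπ * sπ from hππ.symm, ← sub_nonneg]
  have hid : sπ * sπ / 2 * (bt * Real.exp (-bt) / (1 - Real.exp (-2 * bt))) -
      bt * Real.sqrt bt * Real.exp (-bt) * sπ / Real.sqrt 2 =
      (bt * Real.exp (-bt) * sπ) * (sπ / (1 - Real.exp (-2 * bt)) / 2 - Real.sqrt bt / Real.sqrt 2) := by
    ring
  rw [hid]
  refine mul_nonneg (mul_nonneg (mul_nonneg hbt0.le (Real.exp_pos _).le) hsπ.le) (sub_nonneg.mpr ?_)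
  rw [div_div, div_le_div_iff₀ hs2 (by positivity)]
  linarith [key]

end Summit.Ventures.LatticeQCDFlow.Exactness
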